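import Literature.NumberTheory.EllipticCurves.GreenbergVatsal2000.CharacterLambdaCertificateProofs
import HarnessLib

/-!
# Greenberg–Vatsal 2000 §3 (26)/(27): the `λ = 3` CERTIFICATE — `ord_T(L_{Σ₀}(C ⊗ χ, T) mod p) = 3`
# (resp. for `D`) from FOUR interpolation values (THEOREMS)

HONEST FRAMING (cell `bsd-eis`, seat `bsd-eis-x3` gen 4; FULL-BSD rank-`≤ 1` programme D-0033): theorems
only, no named fact; nothing booked. The `a = 3` instance of the divided-difference kernel
`order_toNat_eq_of_isCharacterLFunctionC/D_of_lagrange` (`CharacterLambdaCertificateProofs.lean`;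
Greenberg 2001 §4 p. 356), with the four Lagrange divided differences at the nodes
`x_i = κ(γ)^{±i} − 1` written out: `L₀ = V₁`, `L₁ = (V₂ − V₁)/x₁`,
`L₂ = V₁/(x₁x₂) + V₂/(x₁(x₁ − x₂)) + V₃/(x₂(x₂ − x₁))`,
`L₃ = −V₁/(x₁x₂x₃) + V₂/(x₁(x₁−x₂)(x₁−x₃)) + V₃/(x₂(x₂−x₁)(x₂−x₃)) + V₄/(x₃(x₃−x₁)(x₃−x₂))`;
`‖L₀‖, ‖L₁‖, ‖L₂‖ < 1 ≤ ‖L₃‖` certifies `ord_T = 3`. Companion of the `λ = 1, 2` files.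

* `order_toNat_eq_three_of_isCharacterLFunctionC`, `order_toNat_eq_three_of_isCharacterLFunctionD`.

References: [GreenbergVatsal2000] §3 pp. 41–42 ((26), (27)); [Greenberg2001PastPresent] §4 pp. 355–356.
-/

noncomputable section

open scoped Classical

open Finset NumberField IsDedekindDomain Literature.NumberTheory.EllipticCurves

namespace Literature.NumberTheory.EllipticCurves.GreenbergVatsal2000

variable (p : ℕ) [Fact p.Prime] {m d : ℕ} (φ : DirichletCharacter (ZMod p) m)
  (ψ : DirichletCharacter (ZMod p) d) (S₀ : Finset (HeightOneSpectrum (𝓞 ℚ)))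

/-- `(range 2).erase 0 = {1}`. [folklore] -/
private theorem range_two_erase_zero'' : (range 2).erase 0 = {1} := by decide

/-- `(range 2).erase 1 = {0}`. [folklore] -/
private theorem range_two_erase_one'' : (range 2).erase 1 = {0} := by decide

/-- `(range 3).erase 0 = {1, 2}`. [folklore] -/
private theorem range_three_erase_zero' : (range 3).erase 0 = {1, 2} := by decide

/-- `(range 3).erase 1 = {0, 2}`. [folklore] -/
private theorem range_three_erase_one' : (range 3).erase 1 = {0, 2} := by decide

/-- `(range 3).erase 2 = {0, 1}`. [folklore] -/
private theorem range_three_erase_two' : (range 3).erase 2 = {0, 1} := by decide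

/-- `(range 4).erase 0 = {1, 2, 3}`. [folklore] -/
private theorem range_four_erase_zero : (range 4).erase 0 = {1, 2, 3} := by decide

/-- `(range 4).erase 1 = {0, 2, 3}`. [folklore] -/
private theorem range_four_erase_one : (range 4).erase 1 = {0, 2, 3} := by decide

/-- `(range 4).erase 2 = {0, 1, 3}`. [folklore] -/
private theorem range_four_erase_two : (range 4).erase 2 = {0, 1, 3} := by decide

/-- `(range 4).erase 3 = {0, 1, 2}`. [folklore] -/
private theorem range_four_erase_three : (range 4).erase 3 = {0, 1, 2} := by decide

/-- **`λ = 3` certificate for `L_{Σ₀}(C ⊗ χ, T)`**: with `V_k = characterLValueC p θ Σ₀ k` and the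
nodes `x_i = κ^{i} − 1`, if `‖L₀‖, ‖L₁‖, ‖L₂‖ < 1 ≤ ‖L₃‖` for the four Lagrange divided differences
written out below, then `ord_T(g mod p) = 3`. [cite: GreenbergVatsal2000, §3 p. 41 (26)] [cite: Greenberg2001PastPresent, §4 p. 356] -/
theorem order_toNat_eq_three_of_isCharacterLFunctionC {g : IwasawaAlgebra p}
    (hg : IsCharacterLFunctionC p φ S₀ g) (h0 : ‖characterLValueC p φ S₀ 1‖ < 1)
    (h1 : ‖(characterLValueC p φ S₀ 2 - characterLValueC p φ S₀ 1) / (((cyclotomicGenerator p : ℕ) : ℚ_[p]) - 1)‖ < 1)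
    (h2 : ‖characterLValueC p φ S₀ 1 / ((((cyclotomicGenerator p : ℕ) : ℚ_[p]) - 1) * (((cyclotomicGenerator p : ℕ) : ℚ_[p]) ^ 2 - 1)) + characterLValueC p φ S₀ 2 / ((((cyclotomicGenerator p : ℕ) : ℚ_[p]) - 1) * ((((cyclotomicGenerator p : ℕ) : ℚ_[p]) - 1) - (((cyclotomicGenerator p : ℕ) : ℚ_[p]) ^ 2 - 1))) + characterLValueC p φ S₀ 3 / ((((cyclotomicGenerator p : ℕ) : ℚ_[p]) ^ 2 - 1) * ((((cyclotomicGenerator p : ℕ) : ℚ_[p]) ^ 2 - 1) - (((cyclotomicGenerator p : ℕ) : ℚ_[p]) - 1)))‖ < 1)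
    (h3 : 1 ≤ ‖-(characterLValueC p φ S₀ 1 / ((((cyclotomicGenerator p : ℕ) : ℚ_[p]) - 1) * ((((cyclotomicGenerator p : ℕ) : ℚ_[p]) ^ 2 - 1) * (((cyclotomicGenerator p : ℕ) : ℚ_[p]) ^ 3 - 1)))) + characterLValueC p φ S₀ 2 / ((((cyclotomicGenerator p : ℕ) : ℚ_[p]) - 1) * (((((cyclotomicGenerator p : ℕ) : ℚ_[p]) - 1) - (((cyclotomicGenerator p : ℕ) : ℚ_[p]) ^ 2 - 1)) * ((((cyclotomicGenerator p : ℕ) : ℚ_[p]) - 1) - (((cyclotomicGenerator p : ℕ) : ℚ_[p]) ^ 3 - 1)))) + characterLValueC p φ S₀ 3 / ((((cyclotomicGenerator p : ℕ) : ℚ_[p]) ^ 2 - 1) * (((((cyclotomicGenerator p : ℕ) : ℚ_[p]) ^ 2 - 1) - (((cyclotomicGenerator p : ℕ) : ℚ_[p]) - 1)) * ((((cyclotomicGenerator p : ℕ) : ℚ_[p]) ^ 2 - 1) - (((cyclotomicGenerator p : ℕ) : ℚ_[p]) ^ 3 - 1)))) + characterLValueC p φ S₀ 4 / ((((cyclotomicGenerator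 p : ℕ) : ℚ_[p]) ^ 3 - 1) * (((((cyclotomicGenerator p : ℕ) : ℚ_[p]) ^ 3 - 1) - (((cyclotomicGenerator p : ℕ) : ℚ_[p]) - 1)) * ((((cyclotomicGenerator p : ℕ) : ℚ_[p]) ^ 3 - 1) - (((cyclotomicGenerator p : ℕ) : ℚ_[p]) ^ 2 - 1))))‖) :
    (PowerSeries.map (PadicInt.toZMod (p := p)) g).order.toNat = 3 := by
  have h01 : (0 : ℕ) ≠ 1 := by decide
  have h02 : (0 : ℕ) ≠ 2 := by decide
  have h12 : (1 : ℕ) ≠ 2 := by decide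
  have e1 : ∑ i ∈ range (1 + 1), characterLValueC p φ S₀ (i + 1) / ∏ k ∈ (range (1 + 1)).erase i, ((((cyclotomicGenerator p : ℕ) : ℚ_[p]) ^ i - 1) - (((cyclotomicGenerator p : ℕ) : ℚ_[p]) ^ k - 1)) =
      (characterLValueC p φ S₀ 2 - characterLValueC p φ S₀ 1) / (((cyclotomicGenerator p : ℕ) : ℚ_[p]) - 1) := by
    rw [Finset.sum_range_succ, Finset.sum_range_one, show (1 + 1 : ℕ) = 2 from rfl,
      range_two_erase_zero'', range_two_erase_one'', Finset.prod_singleton, Finset.prod_singleton,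
      pow_zero, pow_one]
    simp only [sub_self, zero_sub, sub_zero, div_neg]
    ring
  have e2 : ∑ i ∈ range (2 + 1), characterLValueC p φ S₀ (i + 1) / ∏ k ∈ (range (2 + 1)).erase i, ((((cyclotomicGenerator p : ℕ) : ℚ_[p]) ^ i - 1) - (((cyclotomicGenerator p : ℕ) : ℚ_[p]) ^ k - 1)) =
      characterLValueC p φ S₀ 1 / ((((cyclotomicGenerator p : ℕ) : ℚ_[p]) - 1) * (((cyclotomicGenerator p : ℕ) : ℚ_[p]) ^ 2 - 1)) + characterLValueC p φ S₀ 2 / ((((cyclotomicGenerator p : ℕ) : ℚ_[p]) - 1) * ((((cyclotomicGenerator p : ℕ) : ℚ_[p]) - 1) - (((cyclotomicGenerator p : ℕ) : ℚ_[p]) ^ 2 - 1))) + characterLValueC p φ S₀ 3 / ((((cyclotomicGenerator p : ℕ) : ℚ_[p]) ^ 2 - 1) * ((((cyclotomicGenerator p : ℕ) : ℚ_[p]) ^ 2 - 1) - (((cyclotomicGenerator p : ℕ) : ℚ_[p]) - 1))) := by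
    rw [Finset.sum_range_succ, Finset.sum_range_succ, Finset.sum_range_one, show (2 + 1 : ℕ) = 3 from rfl,
      range_three_erase_zero', range_three_erase_one', range_three_erase_two',
      Finset.prod_pair h12, Finset.prod_pair h02, Finset.prod_pair h01, pow_zero, pow_one]
    simp only [sub_self, zero_sub, sub_zero, neg_mul_neg]
  have e3 : ∑ i ∈ range (3 + 1), characterLValueC p φ S₀ (i + 1) / ∏ k ∈ (range (3 + 1)).erase i, ((((cyclotomicGenerator p : ℕ) : ℚ_[p]) ^ i - 1) - (((cyclotomicGenerator p : ℕ) : ℚ_[p]) ^ k - 1)) =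
      -(characterLValueC p φ S₀ 1 / ((((cyclotomicGenerator p : ℕ) : ℚ_[p]) - 1) * ((((cyclotomicGenerator p : ℕ) : ℚ_[p]) ^ 2 - 1) * (((cyclotomicGenerator p : ℕ) : ℚ_[p]) ^ 3 - 1)))) + characterLValueC p φ S₀ 2 / ((((cyclotomicGenerator p : ℕ) : ℚ_[p]) - 1) * (((((cyclotomicGenerator p : ℕ) : ℚ_[p]) - 1) - (((cyclotomicGenerator p : ℕ) : ℚ_[p]) ^ 2 - 1)) * ((((cyclotomicGenerator p : ℕ) : ℚ_[p]) - 1) - (((cyclotomicGenerator p : ℕ) : ℚ_[p]) ^ 3 - 1)))) + characterLValueC p φ S₀ 3 / ((((cyclotomicGenerator p : ℕ) : ℚ_[p]) ^ 2 - 1) * (((((cyclotomicGenerator p : ℕ) : ℚ_[p]) ^ 2 - 1) - (((cyclotomicGenerator p : ℕ) : ℚ_[p]) - 1)) * ((((cyclotomicGenerator p : ℕ) : ℚ_[p]) ^ 2 - 1) - (((cyclotomicGenerator p : ℕ) : ℚ_[p]) ^ 3 - 1)))) + characterLValueC p φ S₀ 4 / ((((cyclotomicGenerator p : ℕ) : ℚ_[p])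 ^ 3 - 1) * (((((cyclotomicGenerator p : ℕ) : ℚ_[p]) ^ 3 - 1) - (((cyclotomicGenerator p : ℕ) : ℚ_[p]) - 1)) * ((((cyclotomicGenerator p : ℕ) : ℚ_[p]) ^ 3 - 1) - (((cyclotomicGenerator p : ℕ) : ℚ_[p]) ^ 2 - 1)))) := by
    rw [Finset.sum_range_succ, Finset.sum_range_succ, Finset.sum_range_succ, Finset.sum_range_one,
      show (3 + 1 : ℕ) = 4 from rfl, range_four_erase_zero, range_four_erase_one, range_four_erase_two,
      range_four_erase_three,
      Finset.prod_insert (by decide : (1 : ℕ) ∉ ({2, 3} : Finset ℕ)),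
      Finset.prod_insert (by decide : (0 : ℕ) ∉ ({2, 3} : Finset ℕ)),
      Finset.prod_insert (by decide : (0 : ℕ) ∉ ({1, 3} : Finset ℕ)),
      Finset.prod_insert (by decide : (0 : ℕ) ∉ ({1, 2} : Finset ℕ)),
      Finset.prod_pair (by decide : (2 : ℕ) ≠ 3), Finset.prod_pair (by decide : (2 : ℕ) ≠ 3),
      Finset.prod_pair (by decide : (1 : ℕ) ≠ 3), Finset.prod_pair h12, pow_zero, pow_one]
    simp only [sub_self, zero_sub, sub_zero, mul_neg, neg_mul, div_neg, neg_neg]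
  refine order_toNat_eq_of_isCharacterLFunctionC_of_lagrange p φ S₀ hg (a := 3) ?_ ?_
  · intro j hj
    rcases (by omega : j = 0 ∨ j = 1 ∨ j = 2) with rfl | rfl | rfl
    · simpa using h0
    · rw [e1]; exact h1
    · rw [e2]; exact h2
  · rw [e3]; exact h3

/-- **`λ = 3` certificate for `L_{Σ₀}(D ⊗ χ, T)`**: with `V_k = characterLValueD p θ Σ₀ k` and the
nodes `x_i = κ^{−i} − 1`, if `‖L₀‖, ‖L₁‖, ‖L₂‖ < 1 ≤ ‖L₃‖` for the four Lagrange divided differences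
written out below, then `ord_T(g mod p) = 3`. [cite: GreenbergVatsal2000, §3 p. 42 (27)] [cite: Greenberg2001PastPresent, §4 p. 356] -/
theorem order_toNat_eq_three_of_isCharacterLFunctionD {g : IwasawaAlgebra p}
    (hg : IsCharacterLFunctionD p ψ S₀ g) (h0 : ‖characterLValueD p ψ S₀ 1‖ < 1)
    (h1 : ‖(characterLValueD p ψ S₀ 2 - characterLValueD p ψ S₀ 1) / ((((cyclotomicGenerator p : ℕ) : ℚ_[p])⁻¹) - 1)‖ < 1)
    (h2 : ‖characterLValueD p ψ S₀ 1 / (((((cyclotomicGenerator p : ℕ) : ℚ_[p])⁻¹) - 1) * ((((cyclotomicGenerator p : ℕ) : ℚ_[p])⁻¹) ^ 2 - 1)) + characterLValueD p ψ S₀ 2 / (((((cyclotomicGenerator p : ℕ) : ℚ_[p])⁻¹) - 1) * (((((cyclotomicGenerator p : ℕ) : ℚ_[p])⁻¹) - 1) - ((((cyclotomicGenerator p : ℕ) : ℚ_[p])⁻¹) ^ 2 - 1))) + characterLValueD p ψ S₀ 3 / (((((cyclotomicGenerator p : ℕ) : ℚ_[p])⁻¹) ^ 2 - 1) * (((((cyclotomicGenerator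 p : ℕ) : ℚ_[p])⁻¹) ^ 2 - 1) - ((((cyclotomicGenerator p : ℕ) : ℚ_[p])⁻¹) - 1)))‖ < 1)
    (h3 : 1 ≤ ‖-(characterLValueD p ψ S₀ 1 / (((((cyclotomicGenerator p : ℕ) : ℚ_[p])⁻¹) - 1) * (((((cyclotomicGenerator p : ℕ) : ℚ_[p])⁻¹) ^ 2 - 1) * ((((cyclotomicGenerator p : ℕ) : ℚ_[p])⁻¹) ^ 3 - 1)))) + characterLValueD p ψ S₀ 2 / (((((cyclotomicGenerator p : ℕ) : ℚ_[p])⁻¹) - 1) * ((((((cyclotomicGenerator p : ℕ) : ℚ_[p])⁻¹) - 1) - ((((cyclotomicGenerator p : ℕ) : ℚ_[p])⁻¹) ^ 2 - 1)) * (((((cyclotomicGenerator p : ℕ) : ℚ_[p])⁻¹) - 1) - ((((cyclotomicGenerator p : ℕ) : ℚ_[p])⁻¹) ^ 3 - 1)))) + characterLValueD p ψ S₀ 3 / (((((cyclotomicGenerator p : ℕ) : ℚ_[p])⁻¹) ^ 2 - 1) * ((((((cyclotomicGenerator p : ℕ) : ℚ_[p])⁻¹) ^ 2 - 1) - ((((cyclotomicGenerator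 p : ℕ) : ℚ_[p])⁻¹) - 1)) * (((((cyclotomicGenerator p : ℕ) : ℚ_[p])⁻¹) ^ 2 - 1) - ((((cyclotomicGenerator p : ℕ) : ℚ_[p])⁻¹) ^ 3 - 1)))) + characterLValueD p ψ S₀ 4 / (((((cyclotomicGenerator p : ℕ) : ℚ_[p])⁻¹) ^ 3 - 1) * ((((((cyclotomicGenerator p : ℕ) : ℚ_[p])⁻¹) ^ 3 - 1) - ((((cyclotomicGenerator p : ℕ) : ℚ_[p])⁻¹) - 1)) * (((((cyclotomicGenerator p : ℕ) : ℚ_[p])⁻¹) ^ 3 - 1) - ((((cyclotomicGenerator p : ℕ) : ℚ_[p])⁻¹) ^ 2 - 1))))‖) :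
    (PowerSeries.map (PadicInt.toZMod (p := p)) g).order.toNat = 3 := by
  have h01 : (0 : ℕ) ≠ 1 := by decide
  have h02 : (0 : ℕ) ≠ 2 := by decide
  have h12 : (1 : ℕ) ≠ 2 := by decide
  have e1 : ∑ i ∈ range (1 + 1), characterLValueD p ψ S₀ (i + 1) / ∏ k ∈ (range (1 + 1)).erase i, (((((cyclotomicGenerator p : ℕ) : ℚ_[p])⁻¹) ^ i - 1) - ((((cyclotomicGenerator p : ℕ) : ℚ_[p])⁻¹) ^ k - 1)) =
      (characterLValueD p ψ S₀ 2 - characterLValueD p ψ S₀ 1) / ((((cyclotomicGenerator p : ℕ) : ℚ_[p])⁻¹) - 1) := by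
    rw [Finset.sum_range_succ, Finset.sum_range_one, show (1 + 1 : ℕ) = 2 from rfl,
      range_two_erase_zero'', range_two_erase_one'', Finset.prod_singleton, Finset.prod_singleton,
      pow_zero, pow_one]
    simp only [sub_self, zero_sub, sub_zero, div_neg]
    ring
  have e2 : ∑ i ∈ range (2 + 1), characterLValueD p ψ S₀ (i + 1) / ∏ k ∈ (range (2 + 1)).erase i, (((((cyclotomicGenerator p : ℕ) : ℚ_[p])⁻¹) ^ i - 1) - ((((cyclotomicGenerator p : ℕ) : ℚ_[p])⁻¹) ^ k - 1)) =
      characterLValueD p ψ S₀ 1 / (((((cyclotomicGenerator p : ℕ) : ℚ_[p])⁻¹) - 1) * ((((cyclotomicGenerator p : ℕ) : ℚ_[p])⁻¹) ^ 2 - 1)) + characterLValueD p ψ S₀ 2 / (((((cyclotomicGenerator p : ℕ) : ℚ_[p])⁻¹) - 1) * (((((cyclotomicGenerator p : ℕ) : ℚ_[p])⁻¹) - 1) - ((((cyclotomicGenerator p : ℕ) : ℚ_[p])⁻¹) ^ 2 - 1))) + characterLValueD p ψ S₀ 3 / (((((cyclotomicGenerator p : ℕ) : ℚ_[p])⁻¹)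 ^ 2 - 1) * (((((cyclotomicGenerator p : ℕ) : ℚ_[p])⁻¹) ^ 2 - 1) - ((((cyclotomicGenerator p : ℕ) : ℚ_[p])⁻¹) - 1))) := by
    rw [Finset.sum_range_succ, Finset.sum_range_succ, Finset.sum_range_one, show (2 + 1 : ℕ) = 3 from rfl,
      range_three_erase_zero', range_three_erase_one', range_three_erase_two',
      Finset.prod_pair h12, Finset.prod_pair h02, Finset.prod_pair h01, pow_zero, pow_one]
    simp only [sub_self, zero_sub, sub_zero, neg_mul_neg]
  have e3 : ∑ i ∈ range (3 + 1), characterLValueD p ψ S₀ (i + 1) / ∏ k ∈ (range (3 + 1)).erase i, (((((cyclotomicGenerator p : ℕ) : ℚ_[p])⁻¹) ^ i - 1) - ((((cyclotomicGenerator p : ℕ) : ℚ_[p])⁻¹) ^ k - 1)) =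
      -(characterLValueD p ψ S₀ 1 / (((((cyclotomicGenerator p : ℕ) : ℚ_[p])⁻¹) - 1) * (((((cyclotomicGenerator p : ℕ) : ℚ_[p])⁻¹) ^ 2 - 1) * ((((cyclotomicGenerator p : ℕ) : ℚ_[p])⁻¹) ^ 3 - 1)))) + characterLValueD p ψ S₀ 2 / (((((cyclotomicGenerator p : ℕ) : ℚ_[p])⁻¹) - 1) * ((((((cyclotomicGenerator p : ℕ) : ℚ_[p])⁻¹) - 1) - ((((cyclotomicGenerator p : ℕ) : ℚ_[p])⁻¹) ^ 2 - 1)) * (((((cyclotomicGenerator p : ℕ) : ℚ_[p])⁻¹) - 1) - ((((cyclotomicGenerator p : ℕ) : ℚ_[p])⁻¹) ^ 3 - 1)))) + characterLValueD p ψ S₀ 3 / (((((cyclotomicGenerator p : ℕ) : ℚ_[p])⁻¹) ^ 2 - 1) * ((((((cyclotomicGenerator p : ℕ) : ℚ_[p])⁻¹) ^ 2 - 1) - ((((cyclotomicGenerator p : ℕ) : ℚ_[p])⁻¹) - 1)) * (((((cyclotomicGenerator p : ℕ) : ℚ_[p])⁻¹) ^ 2 - 1) - ((((cyclotomicGenerator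 p : ℕ) : ℚ_[p])⁻¹) ^ 3 - 1)))) + characterLValueD p ψ S₀ 4 / (((((cyclotomicGenerator p : ℕ) : ℚ_[p])⁻¹) ^ 3 - 1) * ((((((cyclotomicGenerator p : ℕ) : ℚ_[p])⁻¹) ^ 3 - 1) - ((((cyclotomicGenerator p : ℕ) : ℚ_[p])⁻¹) - 1)) * (((((cyclotomicGenerator p : ℕ) : ℚ_[p])⁻¹) ^ 3 - 1) - ((((cyclotomicGenerator p : ℕ) : ℚ_[p])⁻¹) ^ 2 - 1)))) := by
    rw [Finset.sum_range_succ, Finset.sum_range_succ, Finset.sum_range_succ, Finset.sum_range_one,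
      show (3 + 1 : ℕ) = 4 from rfl, range_four_erase_zero, range_four_erase_one, range_four_erase_two,
      range_four_erase_three,
      Finset.prod_insert (by decide : (1 : ℕ) ∉ ({2, 3} : Finset ℕ)),
      Finset.prod_insert (by decide : (0 : ℕ) ∉ ({2, 3} : Finset ℕ)),
      Finset.prod_insert (by decide : (0 : ℕ) ∉ ({1, 3} : Finset ℕ)),
      Finset.prod_insert (by decide : (0 : ℕ) ∉ ({1, 2} : Finset ℕ)),
      Finset.prod_pair (by decide : (2 : ℕ) ≠ 3), Finset.prod_pair (by decide : (2 : ℕ) ≠ 3),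
      Finset.prod_pair (by decide : (1 : ℕ) ≠ 3), Finset.prod_pair h12, pow_zero, pow_one]
    simp only [sub_self, zero_sub, sub_zero, mul_neg, neg_mul, div_neg, neg_neg]
  refine order_toNat_eq_of_isCharacterLFunctionD_of_lagrange p ψ S₀ hg (a := 3) ?_ ?_
  · intro j hj
    rcases (by omega : j = 0 ∨ j = 1 ∨ j = 2) with rfl | rfl | rfl
    · simpa using h0
    · rw [e1]; exact h1
    · rw [e2]; exact h2
  · rw [e3]; exact h3

end Literature.NumberTheory.EllipticCurves.GreenbergVatsal2000

end
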